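import Mathlib
import HarnessLib
import Summits.ValiantsHypothesis.ValiantsHypothesis.Theorems.LacunarySymmetroidMatrixDescartesProductPlusOneLetterVariance
import Summits.ValiantsHypothesis.ValiantsHypothesis.Theorems.LacunarySymmetroidMatrixDescartesProductPlusOneLogWronskianSigns

/-!
# LINE (A) `product_plus_one` — `WronskianBudgetK3`: a SHARP MEMBER with SIX positive zeros of `W(∏ f_j)` at m = 4 (val-idea-25 g3 ask W2, 02:16Z)

Crux item stmt-ValiantsHypothesis-18050, floor successor cut EB2-W / def `WronskianBudgetK3` (LINE (A) rev 24; val-idea-25 g3 memo §14d; crit-1 g4 #160 certificate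
family).  The m = 4 member of the owner's certified family, kernel-evaluated: support `d = (0, 1, 6)`, three zero-change rows `f₀ = 1 + x⁶`, `f₁ = 1 + 10⁻¹²x⁶`,
`f₂ = 1 + 10⁻²⁴x⁶` (binomial «pullers» in W-currency: each contributes one positive bump to `W`) and ONE one-change binomial riser `f₃ = 1 − 10⁻⁵x`:

* `wsharp_rows_eval`, `wsharp_rowW_eval` — the rows and their log-Wronskians `W(f_j) = Σ_{l,l'} ((d_l − d_{l'})²/2)·a_{jl}a_{jl'}·t^{d_l+d_{l'}}` at a point
  (✓ `eval_fewnomial`, ✓ `eval_logWronskian_fewnomial`);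
* `wsharp_W_eval` — `W(P)(t) = P(t)²·Σ_j W(f_j)(t)/f_j(t)²` off the rows' zeros (✓ `theta_wronskian_prod`, ✓ `wronskian_sum_eq_prod_sq_mul`);
* `wsharp_signs` — exact signs of `W(∏ f_j)` at `t = 10⁻³, 1, 10, 100, 10³, 10⁴, 5·10⁴`: `− + − + − + −` (`norm_num`);
* ★ `wronskianSharp_six_zeros` — SIX distinct positive zeros of `W(∏_j fewnomial d (a j))` in `(10⁻³, 5·10⁴)` (IVT ×6): with m = 4 rows (three zero-change) the
  constant of EB2-W cannot be below «2 per zero-change row» on this family (crit-1 #160: 2n alternations for n pullers).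

HONEST FRAMING: one explicit member, kernel-evaluated; a located datum on the constant of the CONJECTURE EB2-W; nothing here is a stub or closes anything;
`WronskianBudgetK3` / `OneChangeFloorK3` / 18050 / MatrixDescartes OPEN; `VP ≠ VNP` NOT proved.  No definitions, no named facts.
-/

set_option linter.dupNamespace false

namespace Summit.ValiantsHypothesis.ValiantsHypothesis.Theorems.LacunarySymmetroidMatrixDescartes

namespace ProductPlusOne

open Polynomial Finset
open scoped BigOperators

/-- The rows of the member at a point. [this file's lemma] -/
theorem wsharp_rows_eval (t : ℝ) (j : Fin 4) :
    (∑ l, C ((![![(1 : ℝ), 0, 1], ![1, 0, 1 / 10 ^ 12], ![1, 0, 1 / 10 ^ 24], ![1, -1 / 10 ^ 5, 0]] : Fin 4 → Fin 3 → ℝ) j l)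
        * X ^ ((![0, 1, 6] : Fin 3 → ℕ) l) : ℝ[X]).eval t
      = (![1 + t ^ 6, 1 + t ^ 6 / 10 ^ 12, 1 + t ^ 6 / 10 ^ 24, 1 - t / 10 ^ 5] : Fin 4 → ℝ) j := by
  rw [eval_fewnomial]
  fin_cases j
  · simp [Fin.sum_univ_three]
  · simp [Fin.sum_univ_three]; ring
  · simp [Fin.sum_univ_three]; ring
  · simp [Fin.sum_univ_three]; ring

/-- The rows' log-Wronskians at a point: `W(1 + c x⁶) = 36·c·t⁶`, `W(1 − x/10⁵) = −t/10⁵`. [this file's lemma] -/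
theorem wsharp_rowW_eval (t : ℝ) (j : Fin 4) :
    ((∑ l, C ((![![(1 : ℝ), 0, 1], ![1, 0, 1 / 10 ^ 12], ![1, 0, 1 / 10 ^ 24], ![1, -1 / 10 ^ 5, 0]] : Fin 4 → Fin 3 → ℝ) j l)
          * X ^ ((![0, 1, 6] : Fin 3 → ℕ) l) : ℝ[X])
        * (X * derivative (X * derivative (∑ l, C ((![![(1 : ℝ), 0, 1], ![1, 0, 1 / 10 ^ 12], ![1, 0, 1 / 10 ^ 24], ![1, -1 / 10 ^ 5, 0]]
            : Fin 4 → Fin 3 → ℝ) j l) * X ^ ((![0, 1, 6] : Fin 3 → ℕ) l) : ℝ[X])))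
        - (X * derivative (∑ l, C ((![![(1 : ℝ), 0, 1], ![1, 0, 1 / 10 ^ 12], ![1, 0, 1 / 10 ^ 24], ![1, -1 / 10 ^ 5, 0]]
            : Fin 4 → Fin 3 → ℝ) j l) * X ^ ((![0, 1, 6] : Fin 3 → ℕ) l) : ℝ[X])) ^ 2).eval t
      = (![36 * t ^ 6, 36 * t ^ 6 / 10 ^ 12, 36 * t ^ 6 / 10 ^ 24, -t / 10 ^ 5] : Fin 4 → ℝ) j := by
  rw [eval_logWronskian_fewnomial]
  fin_cases j
  · simp [Fin.sum_univ_three]; ring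
  · simp [Fin.sum_univ_three]; ring
  · simp [Fin.sum_univ_three]; ring
  · simp [Fin.sum_univ_three]; ring

/-- **`W(P)(t) = P(t)²·Σ_j W(f_j)(t)/f_j(t)²`** for the member at any `t` where no row vanishes (`0 < t < 10⁵` suffices). [this file's lemma] -/
theorem wsharp_W_eval {t : ℝ} (ht0 : 0 < t) (ht : t < 10 ^ 5) :
    ((∏ j, ∑ l, C ((![![(1 : ℝ), 0, 1], ![1, 0, 1 / 10 ^ 12], ![1, 0, 1 / 10 ^ 24], ![1, -1 / 10 ^ 5, 0]] : Fin 4 → Fin 3 → ℝ) j l)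
          * X ^ ((![0, 1, 6] : Fin 3 → ℕ) l) : ℝ[X])
        * (X * derivative (X * derivative (∏ j, ∑ l, C ((![![(1 : ℝ), 0, 1], ![1, 0, 1 / 10 ^ 12], ![1, 0, 1 / 10 ^ 24], ![1, -1 / 10 ^ 5, 0]]
            : Fin 4 → Fin 3 → ℝ) j l) * X ^ ((![0, 1, 6] : Fin 3 → ℕ) l) : ℝ[X])))
        - (X * derivative (∏ j, ∑ l, C ((![![(1 : ℝ), 0, 1], ![1, 0, 1 / 10 ^ 12], ![1, 0, 1 / 10 ^ 24], ![1, -1 / 10 ^ 5, 0]]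
            : Fin 4 → Fin 3 → ℝ) j l) * X ^ ((![0, 1, 6] : Fin 3 → ℕ) l) : ℝ[X])) ^ 2).eval t
      = ((1 + t ^ 6) * (1 + t ^ 6 / 10 ^ 12) * (1 + t ^ 6 / 10 ^ 24) * (1 - t / 10 ^ 5)) ^ 2
        * (36 * t ^ 6 / (1 + t ^ 6) ^ 2 + (36 * t ^ 6 / 10 ^ 12) / (1 + t ^ 6 / 10 ^ 12) ^ 2
            + (36 * t ^ 6 / 10 ^ 24) / (1 + t ^ 6 / 10 ^ 24) ^ 2 + (-t / 10 ^ 5) / (1 - t / 10 ^ 5) ^ 2) := by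
  have h6 : 0 ≤ t ^ 6 := by positivity
  have hf : ∀ j, (∑ l, C ((![![(1 : ℝ), 0, 1], ![1, 0, 1 / 10 ^ 12], ![1, 0, 1 / 10 ^ 24], ![1, -1 / 10 ^ 5, 0]] : Fin 4 → Fin 3 → ℝ) j l)
        * X ^ ((![0, 1, 6] : Fin 3 → ℕ) l) : ℝ[X]).eval t ≠ 0 := by
    intro j
    rw [wsharp_rows_eval]
    fin_cases j <;> simp <;> intro h <;> nlinarith
  have h := congrArg (Polynomial.eval t) (theta_wronskian_prod (fun j => (∑ l, C ((![![(1 : ℝ), 0, 1], ![1, 0, 1 / 10 ^ 12],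
      ![1, 0, 1 / 10 ^ 24], ![1, -1 / 10 ^ 5, 0]] : Fin 4 → Fin 3 → ℝ) j l) * X ^ ((![0, 1, 6] : Fin 3 → ℕ) l) : ℝ[X])))
  rw [eval_finsetSum] at h
  simp only [eval_mul, eval_prod, eval_pow] at h
  rw [h, wronskian_sum_eq_prod_sq_mul _ hf, eval_prod]
  simp only [wsharp_rows_eval, wsharp_rowW_eval]
  simp only [Fin.prod_univ_four, Fin.sum_univ_four, Matrix.cons_val_zero, Matrix.cons_val_one, Matrix.cons_val_two, Matrix.cons_val_three,
    Matrix.head_cons, Matrix.tail_cons]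

/-- Exact signs of `W(∏ f_j)` at the seven points `10⁻³, 1, 10, 100, 10³, 10⁴, 5·10⁴`: `− + − + − + −`. [this file's lemma] -/
theorem wsharp_signs :
    (∀ t ∈ ({1 / 1000, 10, 1000, 50000} : Set ℝ),
      ((∏ j, ∑ l, C ((![![(1 : ℝ), 0, 1], ![1, 0, 1 / 10 ^ 12], ![1, 0, 1 / 10 ^ 24], ![1, -1 / 10 ^ 5, 0]] : Fin 4 → Fin 3 → ℝ) j l)
            * X ^ ((![0, 1, 6] : Fin 3 → ℕ) l) : ℝ[X])
          * (X * derivative (X * derivative (∏ j, ∑ l, C ((![![(1 : ℝ), 0, 1], ![1, 0, 1 / 10 ^ 12], ![1, 0, 1 / 10 ^ 24], ![1, -1 / 10 ^ 5, 0]]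
              : Fin 4 → Fin 3 → ℝ) j l) * X ^ ((![0, 1, 6] : Fin 3 → ℕ) l) : ℝ[X])))
          - (X * derivative (∏ j, ∑ l, C ((![![(1 : ℝ), 0, 1], ![1, 0, 1 / 10 ^ 12], ![1, 0, 1 / 10 ^ 24], ![1, -1 / 10 ^ 5, 0]]
              : Fin 4 → Fin 3 → ℝ) j l) * X ^ ((![0, 1, 6] : Fin 3 → ℕ) l) : ℝ[X])) ^ 2).eval t < 0) ∧
    (∀ t ∈ ({1, 100, 10000} : Set ℝ), 0 <
      ((∏ j, ∑ l, C ((![![(1 : ℝ), 0, 1], ![1, 0, 1 / 10 ^ 12], ![1, 0, 1 / 10 ^ 24], ![1, -1 / 10 ^ 5, 0]] : Fin 4 → Fin 3 → ℝ) j l)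
            * X ^ ((![0, 1, 6] : Fin 3 → ℕ) l) : ℝ[X])
          * (X * derivative (X * derivative (∏ j, ∑ l, C ((![![(1 : ℝ), 0, 1], ![1, 0, 1 / 10 ^ 12], ![1, 0, 1 / 10 ^ 24], ![1, -1 / 10 ^ 5, 0]]
              : Fin 4 → Fin 3 → ℝ) j l) * X ^ ((![0, 1, 6] : Fin 3 → ℕ) l) : ℝ[X])))
          - (X * derivative (∏ j, ∑ l, C ((![![(1 : ℝ), 0, 1], ![1, 0, 1 / 10 ^ 12], ![1, 0, 1 / 10 ^ 24], ![1, -1 / 10 ^ 5, 0]]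
              : Fin 4 → Fin 3 → ℝ) j l) * X ^ ((![0, 1, 6] : Fin 3 → ℕ) l) : ℝ[X])) ^ 2).eval t) := by
  constructor
  · intro t ht
    simp only [Set.mem_insert_iff, Set.mem_singleton_iff] at ht
    rcases ht with rfl | rfl | rfl | rfl <;> (rw [wsharp_W_eval (by norm_num) (by norm_num)]; norm_num)
  · intro t ht
    simp only [Set.mem_insert_iff, Set.mem_singleton_iff] at ht
    rcases ht with rfl | rfl | rfl <;> (rw [wsharp_W_eval (by norm_num) (by norm_num)]; norm_num)

/-- ★ **A SHARP MEMBER FOR EB2-W's CONSTANT: SIX positive zeros of `W(∏_j fewnomial d (a j))` at m = 4** (three zero-change rows + one one-change binomial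
riser, support `(0,1,6)`), in `(10⁻³, 5·10⁴)`. [this file's theorem] -/
theorem wronskianSharp_six_zeros :
    ∃ x₁ x₂ x₃ x₄ x₅ x₆ : ℝ, 1 / 1000 < x₁ ∧ x₁ < x₂ ∧ x₂ < x₃ ∧ x₃ < x₄ ∧ x₄ < x₅ ∧ x₅ < x₆ ∧ x₆ < 50000 ∧
      ∀ x ∈ ({x₁, x₂, x₃, x₄, x₅, x₆} : Set ℝ),
        ((∏ j, ∑ l, C ((![![(1 : ℝ), 0, 1], ![1, 0, 1 / 10 ^ 12], ![1, 0, 1 / 10 ^ 24], ![1, -1 / 10 ^ 5, 0]] : Fin 4 → Fin 3 → ℝ) j l)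
              * X ^ ((![0, 1, 6] : Fin 3 → ℕ) l) : ℝ[X])
            * (X * derivative (X * derivative (∏ j, ∑ l, C ((![![(1 : ℝ), 0, 1], ![1, 0, 1 / 10 ^ 12], ![1, 0, 1 / 10 ^ 24], ![1, -1 / 10 ^ 5, 0]]
                : Fin 4 → Fin 3 → ℝ) j l) * X ^ ((![0, 1, 6] : Fin 3 → ℕ) l) : ℝ[X])))
            - (X * derivative (∏ j, ∑ l, C ((![![(1 : ℝ), 0, 1], ![1, 0, 1 / 10 ^ 12], ![1, 0, 1 / 10 ^ 24], ![1, -1 / 10 ^ 5, 0]]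
                : Fin 4 → Fin 3 → ℝ) j l) * X ^ ((![0, 1, 6] : Fin 3 → ℕ) l) : ℝ[X])) ^ 2).eval x = 0 := by
  obtain ⟨hneg, hpos⟩ := wsharp_signs
  set W : ℝ[X] := ((∏ j, ∑ l, C ((![![(1 : ℝ), 0, 1], ![1, 0, 1 / 10 ^ 12], ![1, 0, 1 / 10 ^ 24], ![1, -1 / 10 ^ 5, 0]] : Fin 4 → Fin 3 → ℝ) j l)
              * X ^ ((![0, 1, 6] : Fin 3 → ℕ) l) : ℝ[X])
            * (X * derivative (X * derivative (∏ j, ∑ l, C ((![![(1 : ℝ), 0, 1], ![1, 0, 1 / 10 ^ 12], ![1, 0, 1 / 10 ^ 24], ![1, -1 / 10 ^ 5, 0]]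
                : Fin 4 → Fin 3 → ℝ) j l) * X ^ ((![0, 1, 6] : Fin 3 → ℕ) l) : ℝ[X])))
            - (X * derivative (∏ j, ∑ l, C ((![![(1 : ℝ), 0, 1], ![1, 0, 1 / 10 ^ 12], ![1, 0, 1 / 10 ^ 24], ![1, -1 / 10 ^ 5, 0]]
                : Fin 4 → Fin 3 → ℝ) j l) * X ^ ((![0, 1, 6] : Fin 3 → ℕ) l) : ℝ[X])) ^ 2) with hWdef
  have hcont : Continuous fun t => W.eval t := W.continuous
  have h1 : W.eval (1 / 1000) < 0 := hneg _ (by simp)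
  have h2 : 0 < W.eval 1 := hpos _ (by simp)
  have h3 : W.eval 10 < 0 := hneg _ (by simp)
  have h4 : 0 < W.eval 100 := hpos _ (by simp)
  have h5 : W.eval 1000 < 0 := hneg _ (by simp)
  have h6 : 0 < W.eval 10000 := hpos _ (by simp)
  have h7 : W.eval 50000 < 0 := hneg _ (by simp)
  obtain ⟨x₁, hx₁, e₁⟩ := intermediate_value_Ioo (show (1 : ℝ) / 1000 ≤ 1 by norm_num) hcont.continuousOn ⟨h1, h2⟩
  obtain ⟨x₂, hx₂, e₂⟩ := intermediate_value_Ioo' (show (1 : ℝ) ≤ 10 by norm_num) hcont.continuousOn ⟨h3, h2⟩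
  obtain ⟨x₃, hx₃, e₃⟩ := intermediate_value_Ioo (show (10 : ℝ) ≤ 100 by norm_num) hcont.continuousOn ⟨h3, h4⟩
  obtain ⟨x₄, hx₄, e₄⟩ := intermediate_value_Ioo' (show (100 : ℝ) ≤ 1000 by norm_num) hcont.continuousOn ⟨h5, h4⟩
  obtain ⟨x₅, hx₅, e₅⟩ := intermediate_value_Ioo (show (1000 : ℝ) ≤ 10000 by norm_num) hcont.continuousOn ⟨h5, h6⟩
  obtain ⟨x₆, hx₆, e₆⟩ := intermediate_value_Ioo' (show (10000 : ℝ) ≤ 50000 by norm_num) hcont.continuousOn ⟨h7, h6⟩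
  refine ⟨x₁, x₂, x₃, x₄, x₅, x₆, hx₁.1, hx₁.2.trans hx₂.1, hx₂.2.trans hx₃.1, hx₃.2.trans hx₄.1, hx₄.2.trans hx₅.1, hx₅.2.trans hx₆.1,
    hx₆.2, ?_⟩
  intro x hx
  simp only [Set.mem_insert_iff, Set.mem_singleton_iff] at hx
  rcases hx with rfl | rfl | rfl | rfl | rfl | rfl
  exacts [e₁, e₂, e₃, e₄, e₅, e₆]

end ProductPlusOne

end Summit.ValiantsHypothesis.ValiantsHypothesis.Theorems.LacunarySymmetroidMatrixDescartes
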